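import Mathlib
import HarnessLib
import Summits.HubbardSuperconductivity.HubbardSuperconductivity.Theorems.KLProgrammeKLRegimeEngineScaleZeroTwoLegGridDilWeight

/-!
# Route `KLProgramme` — ENGINE child gen 8 (stmt-HubbardSuperconductivity-20437 `KLRegimeEngineV17F2`), class #7 in GRID currency, located risk #9,
# option (T′-B) «PARAMETRISED MIXED CURRENCY» (pen (R60)/(R60b), CHECK (i′) = YES): the SPACE row of the scale-0 frame-`K` base of the grid atom
# in the MIXED currency `(Zs₂·U² + Zs₁·(Nsc+1)U²·|U|)·a·β/(2N)` — every `ĉ`-class factor escorted by `|U|`, Zs₂ = r2d-p1/p564283's `f ↦ κ_R`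
# constant, producer smallness a PURE `U`-row; from the dilated tree weight `1 + t·diam` of `…TwoLegGridDilWeight` with `t` optimised

Cell gate-hubbard-kl, seat hubbard-kl-k3c2-p1 g8 (row «scale-0 Gram step»; checker (i′) of (R60b)).  Answers (R60b): (A) both `U`-free pieces of
p570023's `ĉ`-row are ARTEFACTS — the head came from `U² ≤ ĉ`, the tail `(8e⁴m_R)²·((Nsc+1)U²)²` from the FIXED weight `t = 1` squaring the profile
`ℓ¹(K) + M₁(K)`; with `wt_t = 1 + t·diam` the row is `≤ (8/t)e²a·(p + t·q)²·β/(2N)`, `p = 4e⁴ℓ¹(K) + 16e⁸κ₀²|U| ≤ (4e⁴κ_R + 16e⁸κ₀²)|U|`,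
`q = 4e⁴M₁(K) ≤ 8e⁴m_R(Nsc+1)U²`, and `t = min(1, p/q)` gives `8e²a(p² + 4pq)·β/(2N)` — the K–C–K chains' genuine content `ℓ¹(K)·M₁(K)` is there,
in the `ĉ·|U|` class (`ℓ¹(K) ≤ κ_R|U|` is order 0 of `FrameOK`); (B) both sizes are INSIDE `FrameOK R U Nsc μ K` (+ `R.WF`, `0 < |U| ≤ 1`):
`ℓ¹ ≤ κ_R|U|` (`sum_norm_framePosKernel_le_linear_of_frameOK`), `M₁ ≤ 2(Nsc+1)U²m_R` (`sum_abs_mul_norm_framePosKernel_le_of_frameOK`) — NO extra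
binder, the row keeps `(Nsc+1)U²` explicit and the closers substitute `(Nsc+1)U² ≤ ĉ` (`nScales_succ_mul_sq_le`: `ĉ = c/log 4`); (C) the producer
smallness is the PURE `U`-row `2e·a·(4e⁴κ_R + 16e⁸κ₀²)·|U| ≤ 1/2` — no c-row survives.

* §1 **`twoLegGrid_space_row_scaleZero_of_frameOK_dil`** — p564283's binders, any `0 < t ≤ 1`, sizes `Σ_z ‖Ǩ_L z‖ ≤ ℓ`, `Σ_z ‖Ǩ_L z‖·|z|_∞ ≤ m`,
  smallness `e·a·(4e⁴(ℓ + t·m) + 16e⁸κ₀²|U|) ≤ 1/2` ⇒ space row `≤ (8/t)·e²·a·(4e⁴(ℓ + t·m) + 16e⁸κ₀²|U|)²·β/(2N)`;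
* §2 `sum_norm_framePosKernel_mul_dist_le_of_frameOK` (`M₁ ≤ 2(Nsc+1)U²m_R`), `mixed_opt_arith` (the choice of `t`),
  **`twoLegGrid_space_row_scaleZero_of_frameOK_mixed`** — p564283's binders (no `f`) + the `U`-row `2e·a·(4e⁴κ_R + 16e⁸κ₀²)·|U| ≤ 1/2` ⇒
  space row `≤ (8e²(4e⁴κ_R + 16e⁸κ₀²)²·U² + 256e⁶(4e⁴κ_R + 16e⁸κ₀²)·m_R·((Nsc+1)U²)·|U|)·a·β/(2N)`,
  `κ_R = 256((4/3)√(24π²(Gfr₀+1)(Gfr₂+1)) + (128/15)(Gfr₀+1))`, `m_R = 6(πGfr₁/2 + π²Gfr₂/(2√2) + π³Gfr₃/8)`, `κ₀² = 2(7+1606732)`.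

Raw row inequalities (the (c′) successor atom is the class-#7 owner's); proofs only; no definitions; nothing about the model's sizes is asserted;
nothing asserts superconductivity.  `--supports stmt-HubbardSuperconductivity-20437`.  References: BGM 2006 §2.3 (2.17), §3 (3.2)–(3.8)
[cite: BenfattoGiulianiMastropietro2006]; Pedra–Salmhofer 2008 Thm 2.4 [cite: PedraSalmhofer2008].
-/

noncomputable section

namespace Summit.HubbardSuperconductivity.HubbardSuperconductivity.Theorems.EngineV8

set_option linter.dupNamespace false -- summit = problem name (single-conjunct summit), D-0017

open Real Finset Literature.MathematicalPhysics.QuantumLattice Literature.Probability.LatticeModels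
open Literature.Probability.LatticeModels.BattleFederbush GrassmannAlgebra
open Summit.HubbardSuperconductivity.HubbardSuperconductivity.Theorems.KLRegimeSplit
open Summit.HubbardSuperconductivity.HubbardSuperconductivity.Theorems.KLProgrammeLegKernels

/-! ## §1 The SPACE row of the grid atom at `(K, 0)` with the dilated weight -/

section FrameBaseMixed

variable {L M : ℕ} [NeZero L] [NeZero M] {R : RenConsts} {μ U β : ℝ} {Nsc : ℕ} {K : TrigPolyC4v}
set_option maxHeartbeats 400000 in
/-- **THE SPACE ROW AT `(K, 0)` WITH THE DILATED WEIGHT `1 + t·diam`** (`0 < t ≤ 1`): under p564283's binders, with sizes `Σ_z ‖Ǩ_L z‖ ≤ ℓ`,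
`Σ_z ‖Ǩ_L z‖·|z|_∞ ≤ m` and the smallness `e·a·(4e⁴(ℓ + t·m) + 16e⁸κ₀²|U|) ≤ 1/2`:
`Σ_{p₁} [x⃗₁ ≠ x⃗₀](1+|Δx̃₀|+|Δx̃₁|)·‖kernel₂ (W_0[K] − 𝒩_{K,N}) (…)‖ ≤ (8/t)·e²·a·(4e⁴(ℓ + t·m) + 16e⁸κ₀²|U|)²·β/(2N)`. -/
theorem twoLegGrid_space_row_scaleZero_of_frameOK_dil (hK : FrameOK R U Nsc μ K) (hR : R.WF) (hU : 0 < U) (hU1 : |U| ≤ 1)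
    (hβ : klBetaMin ≤ β) (hL : klEngL₃ β U ≤ L) (hM : klEngM₃ β U L ≤ M) {a : ℝ} (ha : 0 < a)
    (hA : klScaleZeroA0 + uvTimeMomentConst klE0 7 32 +
          2 * (uvSpaceMomentConst klE0 1 (uvPieceSq klE0 (uvBaseQ klCutoffX5 klE0 4) (uvBaseQ' klCutoffX5 klE0 4)) +
            (1 / 4 * Real.sqrt (216 * (1 / klE0 + 1 / 2)) *
                ∑ e : Fin 2 × Fin 2, (uvLinV klE0 (1 + (e.1 : ℕ) + (e.2 : ℕ)) *
                    (klCutoffX5 * ((1 + ((e.1 : ℕ) + (e.2 : ℕ)) + 2).factorial : ℝ) * (4 / klE0) ^ (1 + ((e.1 : ℕ) + (e.2 : ℕ)) + 1)) +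
                  uvLinD klE0 (1 + (e.1 : ℕ) + (e.2 : ℕ)) *
                    (klCutoffX5 * ((1 + ((e.1 : ℕ) + (e.2 : ℕ)) + 3).factorial : ℝ) * (4 / klE0) ^ (1 + ((e.1 : ℕ) + (e.2 : ℕ)) + 2)))) *
              (4608 * (1 + R.Gfr 0 + R.Gfr 1 + R.Gfr 2 + R.Gfr 3) ^ 4 * (((Nsc : ℝ) + 1) * U ^ 2 + 2 * |U|))) ≤ a)
    {t : ℝ} (ht0 : 0 < t) (ht1 : t ≤ 1) {ℓ m : ℝ} (hℓ : ∑ z : TorusSite 2 L, ‖framePosKernel L K z‖ ≤ ℓ)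
    (hm : ∑ z : TorusSite 2 L, ‖framePosKernel L K z‖ * torusSiteDist z 0 ≤ m)
    (hsmall : Real.exp 1 * a * (4 * Real.exp 1 ^ 4 * (ℓ + t * m) + 16 * Real.exp 1 ^ 8 * Real.sqrt (2 * (7 + 1606732)) ^ 2 * |U|) ≤ 1 / 2)
    (σ : Fin 2) (p₀ : GridPoint L (2 * (2 * M))) :
    ∑ p₁ : GridPoint L (2 * (2 * M)),
      (if p₁.2 - p₀.2 = 0 then (0 : ℝ) else
        (1 + (((p₁.2 - p₀.2) 0).valMinAbs.natAbs : ℝ) + (((p₁.2 - p₀.2) 1).valMinAbs.natAbs : ℝ))) *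
        ‖kernel ℂ
          (effAction ℂ ((hubbardGridSub L M β (2 * (2 * M))).transpose *
              hubbardCovAboveCT L M β μ 0 K (klScale klE0 0) * hubbardGridSub L M β (2 * (2 * M)))
            (hubbardGridInteraction L (2 * (2 * M)) β U + hubbardGridCounterQuadratic L (2 * (2 * M)) β K) -
            hubbardGridCounterQuadratic L (2 * (2 * M)) β K) 2
          (fun i => ((![p₀, p₁] i, σ), i))‖ ≤
      8 / t * Real.exp 1 ^ 2 * a * (4 * Real.exp 1 ^ 4 * (ℓ + t * m) + 16 * Real.exp 1 ^ 8 * Real.sqrt (2 * (7 + 1606732)) ^ 2 * |U|) ^ 2 *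
        (β / (2 * ((2 * (2 * M) : ℕ) : ℝ))) := by
  haveI : NeZero (2 * (2 * M)) := ⟨by have := NeZero.ne M; omega⟩
  obtain ⟨hL15, hβL, -, -, -, -⟩ := scaleZero_regime_sizes (U := U) hβ hL hM
  have hβ0 : 0 < β := lt_of_lt_of_le (by norm_num [klBetaMin]) hβ
  have hN : (0 : ℝ) < ((2 * (2 * M) : ℕ) : ℝ) := by have := NeZero.ne M; positivity
  have hκ : (0 : ℝ) < Real.sqrt (2 * (7 + 1606732)) := Real.sqrt_pos.2 (by norm_num)
  have hsc : klScale klE0 0 = klE0 := by simp [klScale]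
  -- the dilated tree weight
  set wt : Finset (GridLeg (GridPoint L (2 * (2 * M)))) → ℝ := fun S =>
    diamWeight (fun s => 1 + t * s) (gridLabelDist L (2 * (2 * M)) β) (S.image gridLegPos) with hwt
  have hwtD : IsTreeWeight wt := isTreeWeight_wtDil (L := L) (Ng := 2 * (2 * M)) hβ0.le ht0.le
  have hpair : ∀ X Y : GridLeg (GridPoint L (2 * (2 * M))),
      ({X, Y} : Finset (GridLeg (GridPoint L (2 * (2 * M))))).image gridLegPos = {gridLegPos X, gridLegPos Y} :=
    fun X Y => by rw [image_insert, image_singleton]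
  have hwt_le : ∀ X Y : GridLeg (GridPoint L (2 * (2 * M))), wt {X, Y} ≤ gridLabelWt L (2 * (2 * M)) β {gridLegPos X, gridLegPos Y} := by
    intro X Y
    rw [hwt]; dsimp only
    rw [hpair]
    exact wtDil_le_gridLabelWt (L := L) (Ng := 2 * (2 * M)) ht1 _
  -- covariance: Gram constant, dilated-weighted decay ≤ fully weighted decay
  have hGB := isGramBoundedR_scaleZero_of_frameOK (L := L) (M := M) hK hβ hL15 hβL
  have hαpos : 0 < ((2 * (2 * M) : ℕ) : ℝ) / β * a := by positivity
  have hrow : ∀ X, ∑ Y, ‖((hubbardGridSub L M β (2 * (2 * M))).transpose * hubbardCovAboveCT L M β μ 0 K klE0 *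
      hubbardGridSub L M β (2 * (2 * M))) X Y‖ * wt {X, Y} ≤ ((2 * (2 * M) : ℕ) : ℝ) / β * a :=
    fun X => le_trans (sum_le_sum fun Y _ => mul_le_mul_of_nonneg_left (hwt_le X Y) (norm_nonneg _))
      ((rowSum_scaleZero_gridLabelWt_le_X5 (L := L) (M := M) hK hR hU1 hβ hL hM X).trans
        (mul_le_mul_of_nonneg_left hA (div_nonneg hN.le hβ0.le)))
  have hcol : ∀ Y, ∑ X, ‖((hubbardGridSub L M β (2 * (2 * M))).transpose * hubbardCovAboveCT L M β μ 0 K klE0 *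
      hubbardGridSub L M β (2 * (2 * M))) X Y‖ * wt {X, Y} ≤ ((2 * (2 * M) : ℕ) : ℝ) / β * a :=
    fun Y => le_trans (sum_le_sum fun X _ => mul_le_mul_of_nonneg_left (hwt_le X Y) (norm_nonneg _))
      ((colSum_scaleZero_gridLabelWt_le_X5 (L := L) (M := M) hK hR hU1 hβ hL hM Y).trans
        (mul_le_mul_of_nonneg_left hA (div_nonneg hN.le hβ0.le)))
  -- the dilated pinned profile `ℓ¹(K) + t·M₁(K)` (bound it BEFORE abstracting it: `set` must not unify against `hℓ`/`hm`)
  have hFle : ∑ z : TorusSite 2 L, ‖framePosKernel L K z‖ * (1 + t * torusSiteDist z 0) ≤ ℓ + t * m := by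
    have h1 : ∑ z : TorusSite 2 L, ‖framePosKernel L K z‖ * (1 + t * torusSiteDist z 0) =
        ∑ z : TorusSite 2 L, ‖framePosKernel L K z‖ + t * ∑ z : TorusSite 2 L, ‖framePosKernel L K z‖ * torusSiteDist z 0 := by
      rw [mul_sum, ← sum_add_distrib]
      exact sum_congr rfl fun z _ => by ring
    rw [h1]
    exact add_le_add hℓ (mul_le_mul_of_nonneg_left hm ht0.le)
  clear hℓ hm
  set F : ℝ := ∑ z : TorusSite 2 L, ‖framePosKernel L K z‖ * (1 + t * torusSiteDist z 0) with hF
  have hF0 : 0 ≤ F := sum_nonneg fun z _ => mul_nonneg (norm_nonneg _) (by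
    have : (0 : ℝ) ≤ torusSiteDist z 0 := Nat.cast_nonneg _; nlinarith)
  set Nw : ℕ → ℝ := fun m' => if m' = 1 then |β| / ((2 * (2 * M) : ℕ) : ℝ) * F else if m' = 2 then |U| * |β| / ((2 * (2 * M) : ℕ) : ℝ) else 0
    with hNw
  have hβN : 0 ≤ |β| / ((2 * (2 * M) : ℕ) : ℝ) := div_nonneg (abs_nonneg β) hN.le
  have hNw0 : ∀ m', 0 ≤ Nw m' := fun m' => by
    rw [hNw]; dsimp only
    split_ifs
    · exact mul_nonneg hβN hF0
    · exact div_nonneg (mul_nonneg (abs_nonneg U) (abs_nonneg β)) hN.le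
    · exact le_rfl
  have hNwle : ∀ m' (j : Fin (2 * m')) (w : GridLeg (GridPoint L (2 * (2 * M)))),
      ∑ Y ∈ univ.filter (fun Y : Fin (2 * m') → GridLeg (GridPoint L (2 * (2 * M))) => Y j = w),
        ‖kernel ℂ (hubbardGridInteraction L (2 * (2 * M)) β U + hubbardGridCounterQuadratic L (2 * (2 * M)) β K) (2 * m') Y‖ *
          wt (univ.image Y) ≤ Nw m' :=
    fun m' j w => by
      simpa only [hNw, hF, hwt] using sum_norm_kernel_gridVertex_mul_wtDil_le (L := L) (Ng := 2 * (2 * M)) β U hβ0.le ht0.le ht1 K m' j w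
  -- `‖Ṽ‖_{h,t}` and `θ_t` in closed form
  -- (`P`, `S` are introduced WITHOUT `set`: abstracting them would unify `F` against `ℓ + t·m` through the sum)
  obtain ⟨P, hP⟩ : ∃ P : ℝ, P = 4 * Real.exp 1 ^ 4 * F + 16 * Real.exp 1 ^ 8 * Real.sqrt (2 * (7 + 1606732)) ^ 2 * |U| := ⟨_, rfl⟩
  obtain ⟨S, hS⟩ : ∃ S : ℝ, S = 4 * Real.exp 1 ^ 4 * (ℓ + t * m) + 16 * Real.exp 1 ^ 8 * Real.sqrt (2 * (7 + 1606732)) ^ 2 * |U| :=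
    ⟨_, rfl⟩
  have he0 : 0 ≤ Real.exp 1 := (Real.exp_pos 1).le
  have hP0 : 0 ≤ P := by
    rw [hP]
    exact add_nonneg (mul_nonneg (by positivity) hF0) (by positivity)
  have hPle : P ≤ S := by
    rw [hP, hS]
    have := mul_le_mul_of_nonneg_left hFle (by positivity : (0 : ℝ) ≤ 4 * Real.exp 1 ^ 4)
    linarith
  have he2 : Real.exp 2 = Real.exp 1 ^ 2 := by rw [← Real.exp_nat_mul]; norm_num
  have hnV : normV (GridLeg (GridPoint L (2 * (2 * M)))) (Real.sqrt (2 * (7 + 1606732))) (Real.sqrt (2 * (7 + 1606732))) Nw =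
      |β| / ((2 * (2 * M) : ℕ) : ℝ) * Real.sqrt (2 * (7 + 1606732)) ^ 2 * P := by
    rw [hNw, normV_twoStep_eq (four_le_card_gridLeg (L := L) (Ng := 2 * (2 * M))), he2, hP]
    ring
  have hXeq : (Real.sqrt (2 * (7 + 1606732)))⁻¹ ^ 2 *
      (Real.exp 1 * normV (GridLeg (GridPoint L (2 * (2 * M)))) (Real.sqrt (2 * (7 + 1606732))) (Real.sqrt (2 * (7 + 1606732))) Nw) =
        Real.exp 1 * (β / ((2 * (2 * M) : ℕ) : ℝ)) * P := by
    rw [hnV, abs_of_pos hβ0]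
    field_simp
  have hθeq : Real.exp 1 * (((2 * (2 * M) : ℕ) : ℝ) / β * a) *
      normV (GridLeg (GridPoint L (2 * (2 * M)))) (Real.sqrt (2 * (7 + 1606732))) (Real.sqrt (2 * (7 + 1606732))) Nw /
        Real.sqrt (2 * (7 + 1606732)) ^ 2 = Real.exp 1 * a * P := by
    rw [hnV, abs_of_pos hβ0]
    field_simp
  have hθ0 : 0 ≤ Real.exp 1 * a * P := mul_nonneg (mul_nonneg he0 ha.le) hP0
  have hθle : Real.exp 1 * a * P ≤ 1 / 2 := by
    have : Real.exp 1 * a * P ≤ Real.exp 1 * a * S := mul_le_mul_of_nonneg_left hPle (mul_nonneg he0 ha.le)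
    rw [hS] at this
    exact this.trans hsmall
  have hθlt : Real.exp 1 * (((2 * (2 * M) : ℕ) : ℝ) / β * a) *
      normV (GridLeg (GridPoint L (2 * (2 * M)))) (Real.sqrt (2 * (7 + 1606732))) (Real.sqrt (2 * (7 + 1606732))) Nw /
        Real.sqrt (2 * (7 + 1606732)) ^ 2 < 1 := by
    rw [hθeq]; linarith
  have hX0 : 0 ≤ Real.exp 1 * (β / ((2 * (2 * M) : ℕ) : ℝ)) * P := mul_nonneg (mul_nonneg he0 (div_nonneg hβ0.le hN.le)) hP0
  -- `(2/t)·2·X·θ ≤ (8/t)·e²·a·S²·β/(2N)`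
  have h2t : 0 ≤ 2 / t := by positivity
  have hfin : 2 / t * (2 * (Real.exp 1 * (β / ((2 * (2 * M) : ℕ) : ℝ)) * P) * (Real.exp 1 * a * P)) ≤
      8 / t * Real.exp 1 ^ 2 * a * S ^ 2 * (β / (2 * ((2 * (2 * M) : ℕ) : ℝ))) := by
    have hP2 : P ^ 2 ≤ S ^ 2 := pow_le_pow_left₀ hP0 hPle 2
    have hw : 0 ≤ 2 / t * (2 * Real.exp 1 ^ 2 * a * (β / ((2 * (2 * M) : ℕ) : ℝ))) := by positivity
    calc 2 / t * (2 * (Real.exp 1 * (β / ((2 * (2 * M) : ℕ) : ℝ)) * P) * (Real.exp 1 * a * P))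
        = 2 / t * (2 * Real.exp 1 ^ 2 * a * (β / ((2 * (2 * M) : ℕ) : ℝ))) * P ^ 2 := by ring
      _ ≤ 2 / t * (2 * Real.exp 1 ^ 2 * a * (β / ((2 * (2 * M) : ℕ) : ℝ))) * S ^ 2 := mul_le_mul_of_nonneg_left hP2 hw
      _ = 8 / t * Real.exp 1 ^ 2 * a * S ^ 2 * (β / (2 * ((2 * (2 * M) : ℕ) : ℝ))) := by
          field_simp; ring
  -- the weighted truncated step with the dilated weight and the off-diagonal moment weight (constant `2/t`)
  set ω : (Fin 2 → GridLeg (GridPoint L (2 * (2 * M)))) → ℝ := fun Y => if (Y 1).1.1.2 - (Y 0).1.1.2 = 0 then (0 : ℝ) else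
      (1 + ((((Y 1).1.1.2 - (Y 0).1.1.2) 0).valMinAbs.natAbs : ℝ) + ((((Y 1).1.1.2 - (Y 0).1.1.2) 1).valMinAbs.natAbs : ℝ)) with hω
  have hω0 : ∀ Y, 0 ≤ ω Y := fun Y => by
    rw [hω]; dsimp only
    by_cases hc : (Y 1).1.1.2 - (Y 0).1.1.2 = 0
    · rw [if_pos hc]
    · rw [if_neg hc]
      exact add_nonneg (add_nonneg zero_le_one (Nat.cast_nonneg _)) (Nat.cast_nonneg _)
  have h := twoLeg_offDiag_wsum_le_of_wgridStep _ β U K hwtD hκ hGB Nw hNw0 hNwle hαpos hrow hcol hκ hθlt ω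
    (fun Y hY => by simpa only [hω, pow_one] using offDiagMomentWeight_eq_zero_of_point_eq 1 Y hY) h2t
    (fun Y => by simpa only [hω, hwt] using offDiagMomentWeight_le_dil (L := L) (Ng := 2 * (2 * M)) hβ0.le ht0 ht1 Y)
    (((p₀, σ), 0))
  rw [hsc]
  refine le_trans ?_ (h.trans ?_)
  · refine le_trans (le_of_eq ?_) (sum_point_string_le_sum_pinned (fun Y => ω Y * ‖kernel ℂ (effAction ℂ _
        (hubbardGridInteraction L (2 * (2 * M)) β U + hubbardGridCounterQuadratic L (2 * (2 * M)) β K) -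
          hubbardGridCounterQuadratic L (2 * (2 * M)) β K) 2 Y‖) (fun Y => mul_nonneg (hω0 Y) (norm_nonneg _)) σ p₀)
    refine sum_congr rfl fun p₁ _ => ?_
    simp only [hω, Matrix.cons_val_zero, Matrix.cons_val_one, Matrix.cons_val_fin_one]
  · rw [hXeq, hθeq]
    refine (mul_le_mul_of_nonneg_left (mul_div_one_sub_le_of_le_half hX0 hθ0 hθle) h2t).trans (hfin.trans (le_of_eq ?_))
    rw [hS]

/-! ## §2 The FrameOK sizes, the optimised dilation, and the MIXED-currency space row -/

/-- **The first position moment of an admissible frame's kernel**: `Σ_z ‖Ǩ_L(z)‖·|z|_∞ ≤ 2·(Nsc+1)·U²·m_R` (p3's directional bounds,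
`|z|_∞ ≤ |z̃₀| + |z̃₁|`). -/
theorem sum_norm_framePosKernel_mul_dist_le_of_frameOK (hK : FrameOK R U Nsc μ K) (hR : R.WF) :
    ∑ z : TorusSite 2 L, ‖framePosKernel L K z‖ * torusSiteDist z 0 ≤
      2 * (((Nsc : ℝ) + 1) * U ^ 2 * (6 * (Real.pi * R.Gfr 1 / 2 + Real.pi ^ 2 * R.Gfr 2 / (2 * Real.sqrt 2) + Real.pi ^ 3 * R.Gfr 3 / 8))) := by
  have hG : ∀ j, 0 ≤ R.Gfr j := hR.2.2
  have h1 := sum_abs_mul_norm_framePosKernel_le_of_frameOK (L := L) hG hK 0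
  have h2 := sum_abs_mul_norm_framePosKernel_le_of_frameOK (L := L) hG hK 1
  have hdist : ∀ z : TorusSite 2 L, torusSiteDist z 0 ≤ |((z 0).valMinAbs : ℝ)| + |((z 1).valMinAbs : ℝ)| := by
    intro z
    have h := torusSiteDist_le_abs_add_abs z 0
    rwa [sub_zero] at h
  calc ∑ z : TorusSite 2 L, ‖framePosKernel L K z‖ * torusSiteDist z 0
      ≤ ∑ z : TorusSite 2 L, (|((z 0).valMinAbs : ℝ)| * ‖framePosKernel L K z‖ + |((z 1).valMinAbs : ℝ)| * ‖framePosKernel L K z‖) := by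
        refine sum_le_sum fun z _ => ?_
        have hn := norm_nonneg (framePosKernel L K z)
        nlinarith [hdist z, hn]
    _ = _ := sum_add_distrib
    _ ≤ _ := by rw [two_mul]; exact add_le_add h1 h2

omit [NeZero L] [NeZero M] in
/-- **The choice of the dilation.**  With `p = (4e⁴k_R + 16e⁸k₀)·u > 0` and `q = 4e⁴m ≥ 0` there is `t ∈ (0, 1]` (namely `min(1, p/q)`) with
`p + t·q ≤ 2p` and `(8/t)·e²a·(p + t·q)²·w ≤ 8e²a·(p² + 4pq)·w`. -/
theorem mixed_opt_arith {e a kR k0 m u w : ℝ} (he : 0 < e) (ha : 0 ≤ a) (hkR : 0 ≤ kR) (hk0 : 0 < k0) (hm : 0 ≤ m) (hu : 0 < u)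
    (hw : 0 ≤ w) :
    ∃ t : ℝ, 0 < t ∧ t ≤ 1 ∧
      4 * e ^ 4 * (kR * u + t * m) + 16 * e ^ 8 * k0 * u ≤ 2 * ((4 * e ^ 4 * kR + 16 * e ^ 8 * k0) * u) ∧
      8 / t * e ^ 2 * a * (4 * e ^ 4 * (kR * u + t * m) + 16 * e ^ 8 * k0 * u) ^ 2 * w ≤
        8 * e ^ 2 * a * (((4 * e ^ 4 * kR + 16 * e ^ 8 * k0) * u) ^ 2 + 4 * ((4 * e ^ 4 * kR + 16 * e ^ 8 * k0) * u) * (4 * e ^ 4 * m)) * w := by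
  have he4 : 0 < e ^ 4 := by positivity
  have hp : 0 < (4 * e ^ 4 * kR + 16 * e ^ 8 * k0) * u := by positivity
  have hq : 0 ≤ 4 * e ^ 4 * m := by positivity
  have hcoef : 0 ≤ 8 * e ^ 2 * a * w := by positivity
  -- rewrite the profile as `p + t·q`
  have hid : ∀ t : ℝ, 4 * e ^ 4 * (kR * u + t * m) + 16 * e ^ 8 * k0 * u =
      (4 * e ^ 4 * kR + 16 * e ^ 8 * k0) * u + t * (4 * e ^ 4 * m) := fun t => by ring
  by_cases hqp : 4 * e ^ 4 * m ≤ (4 * e ^ 4 * kR + 16 * e ^ 8 * k0) * u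
  · -- `t = 1`
    refine ⟨1, one_pos, le_rfl, ?_, ?_⟩
    · rw [hid]; linarith
    · rw [hid, div_one, one_mul]
      have hsq : ((4 * e ^ 4 * kR + 16 * e ^ 8 * k0) * u + 4 * e ^ 4 * m) ^ 2 ≤
          ((4 * e ^ 4 * kR + 16 * e ^ 8 * k0) * u) ^ 2 + 4 * ((4 * e ^ 4 * kR + 16 * e ^ 8 * k0) * u) * (4 * e ^ 4 * m) := by
        nlinarith [mul_le_mul_of_nonneg_left hqp hq]
      calc 8 * e ^ 2 * a * ((4 * e ^ 4 * kR + 16 * e ^ 8 * k0) * u + 4 * e ^ 4 * m) ^ 2 * w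
          = 8 * e ^ 2 * a * w * ((4 * e ^ 4 * kR + 16 * e ^ 8 * k0) * u + 4 * e ^ 4 * m) ^ 2 := by ring
        _ ≤ 8 * e ^ 2 * a * w * (((4 * e ^ 4 * kR + 16 * e ^ 8 * k0) * u) ^ 2 +
              4 * ((4 * e ^ 4 * kR + 16 * e ^ 8 * k0) * u) * (4 * e ^ 4 * m)) := mul_le_mul_of_nonneg_left hsq hcoef
        _ = _ := by ring
  · -- `t = p/q < 1`
    have hqp' : (4 * e ^ 4 * kR + 16 * e ^ 8 * k0) * u < 4 * e ^ 4 * m := lt_of_not_ge hqp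
    have hq' : 0 < 4 * e ^ 4 * m := hp.trans hqp'
    set p := (4 * e ^ 4 * kR + 16 * e ^ 8 * k0) * u with hpdef
    set q := 4 * e ^ 4 * m with hqdef
    refine ⟨p / q, div_pos hp hq', (div_le_one hq').2 hqp'.le, ?_, ?_⟩
    · rw [hid, div_mul_cancel₀ p hq'.ne']
      linarith
    · rw [hid, div_mul_cancel₀ p hq'.ne']
      have h1 : 8 / (p / q) * e ^ 2 * a * (p + p) ^ 2 * w = 32 * p * q * (e ^ 2 * a * w) := by
        field_simp
        ring
      rw [h1]
      nlinarith [mul_nonneg (mul_nonneg hp.le hp.le) (by positivity : 0 ≤ e ^ 2 * a * w)]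

/-- **THE SPACE ROW OF THE GRID ATOM AT `(K, 0)` FOR AN ADMISSIBLE FRAME, IN THE MIXED CURRENCY** (check (i′) of (R60b) = YES): under
p564283's binders WITHOUT `f` (`FrameOK R U Nsc μ K`, `R.WF`, `0 < U`, `|U| ≤ 1`, `klBetaMin ≤ β`, the volume thresholds, `a ≥ A(R,U,Nsc)`) and
the PURE `U`-row `2e·a·(4e⁴κ_R + 16e⁸κ₀²)·|U| ≤ 1/2`: for both spins and every grid pin `p₀`,
`Σ_{p₁} [x⃗₁ ≠ x⃗₀](1+|Δx̃₀|+|Δx̃₁|)·‖kernel₂ (W_0[K] − 𝒩_{K,N}) (…)‖ ≤ (8e²(4e⁴κ_R+16e⁸κ₀²)²·U² + 256e⁶(4e⁴κ_R+16e⁸κ₀²)·m_R·((Nsc+1)U²)·|U|)·a·β/(2N)`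
— the `U²` coefficient is p564283's at `f = κ_R`, the second summand is the LEIBNIZ term `ℓ¹(K)·M₁(K)` (every `(Nsc+1)U²` escorted by `|U|`). -/
theorem twoLegGrid_space_row_scaleZero_of_frameOK_mixed (hK : FrameOK R U Nsc μ K) (hR : R.WF) (hU : 0 < U) (hU1 : |U| ≤ 1)
    (hβ : klBetaMin ≤ β) (hL : klEngL₃ β U ≤ L) (hM : klEngM₃ β U L ≤ M) {a : ℝ} (ha : 0 < a)
    (hA : klScaleZeroA0 + uvTimeMomentConst klE0 7 32 +
          2 * (uvSpaceMomentConst klE0 1 (uvPieceSq klE0 (uvBaseQ klCutoffX5 klE0 4) (uvBaseQ' klCutoffX5 klE0 4)) +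
            (1 / 4 * Real.sqrt (216 * (1 / klE0 + 1 / 2)) *
                ∑ e : Fin 2 × Fin 2, (uvLinV klE0 (1 + (e.1 : ℕ) + (e.2 : ℕ)) *
                    (klCutoffX5 * ((1 + ((e.1 : ℕ) + (e.2 : ℕ)) + 2).factorial : ℝ) * (4 / klE0) ^ (1 + ((e.1 : ℕ) + (e.2 : ℕ)) + 1)) +
                  uvLinD klE0 (1 + (e.1 : ℕ) + (e.2 : ℕ)) *
                    (klCutoffX5 * ((1 + ((e.1 : ℕ) + (e.2 : ℕ)) + 3).factorial : ℝ) * (4 / klE0) ^ (1 + ((e.1 : ℕ) + (e.2 : ℕ)) + 2)))) *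
              (4608 * (1 + R.Gfr 0 + R.Gfr 1 + R.Gfr 2 + R.Gfr 3) ^ 4 * (((Nsc : ℝ) + 1) * U ^ 2 + 2 * |U|))) ≤ a)
    (hsmall : 2 * Real.exp 1 * a *
      (4 * Real.exp 1 ^ 4 * (256 * ((4 / 3) * Real.sqrt (24 * π ^ 2 * (R.Gfr 0 + 1) * (R.Gfr 2 + 1)) + (128 / 15) * (R.Gfr 0 + 1))) +
        16 * Real.exp 1 ^ 8 * Real.sqrt (2 * (7 + 1606732)) ^ 2) * |U| ≤ 1 / 2)
    (σ : Fin 2) (p₀ : GridPoint L (2 * (2 * M))) :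
    ∑ p₁ : GridPoint L (2 * (2 * M)),
      (if p₁.2 - p₀.2 = 0 then (0 : ℝ) else
        (1 + (((p₁.2 - p₀.2) 0).valMinAbs.natAbs : ℝ) + (((p₁.2 - p₀.2) 1).valMinAbs.natAbs : ℝ))) *
        ‖kernel ℂ
          (effAction ℂ ((hubbardGridSub L M β (2 * (2 * M))).transpose *
              hubbardCovAboveCT L M β μ 0 K (klScale klE0 0) * hubbardGridSub L M β (2 * (2 * M)))
            (hubbardGridInteraction L (2 * (2 * M)) β U + hubbardGridCounterQuadratic L (2 * (2 * M)) β K) -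
            hubbardGridCounterQuadratic L (2 * (2 * M)) β K) 2
          (fun i => ((![p₀, p₁] i, σ), i))‖ ≤
      (8 * Real.exp 1 ^ 2 *
          (4 * Real.exp 1 ^ 4 * (256 * ((4 / 3) * Real.sqrt (24 * π ^ 2 * (R.Gfr 0 + 1) * (R.Gfr 2 + 1)) + (128 / 15) * (R.Gfr 0 + 1))) +
            16 * Real.exp 1 ^ 8 * Real.sqrt (2 * (7 + 1606732)) ^ 2) ^ 2 * U ^ 2 +
        256 * Real.exp 1 ^ 6 *
          (4 * Real.exp 1 ^ 4 * (256 * ((4 / 3) * Real.sqrt (24 * π ^ 2 * (R.Gfr 0 + 1) * (R.Gfr 2 + 1)) + (128 / 15) * (R.Gfr 0 + 1))) +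
            16 * Real.exp 1 ^ 8 * Real.sqrt (2 * (7 + 1606732)) ^ 2) *
          (6 * (Real.pi * R.Gfr 1 / 2 + Real.pi ^ 2 * R.Gfr 2 / (2 * Real.sqrt 2) + Real.pi ^ 3 * R.Gfr 3 / 8)) * (((Nsc : ℝ) + 1) * U ^ 2) * |U|) *
        a * (β / (2 * ((2 * (2 * M) : ℕ) : ℝ))) := by
  haveI : NeZero (2 * (2 * M)) := ⟨by have := NeZero.ne M; omega⟩
  have hβ0 : 0 < β := lt_of_lt_of_le (by norm_num [klBetaMin]) hβ
  have hw : 0 ≤ β / (2 * ((2 * (2 * M) : ℕ) : ℝ)) := by positivity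
  have hG : ∀ j, 0 ≤ R.Gfr j := hR.2.2
  have he : 0 < Real.exp 1 := Real.exp_pos 1
  have hkR : 0 ≤ 256 * ((4 / 3) * Real.sqrt (24 * π ^ 2 * (R.Gfr 0 + 1) * (R.Gfr 2 + 1)) + (128 / 15) * (R.Gfr 0 + 1)) := by
    have := hG 0; positivity
  have hk0 : 0 < Real.sqrt (2 * (7 + 1606732)) ^ 2 := by positivity
  have hmR : 0 ≤ 2 * (((Nsc : ℝ) + 1) * U ^ 2 * (6 * (Real.pi * R.Gfr 1 / 2 + Real.pi ^ 2 * R.Gfr 2 / (2 * Real.sqrt 2) + Real.pi ^ 3 * R.Gfr 3 / 8))) := by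
    have := hG 1; have := hG 2; have := hG 3; positivity
  have hu : 0 < |U| := abs_pos.2 hU.ne'
  -- the two sizes of the frame kernel, from `FrameOK`
  have hℓ := sum_norm_framePosKernel_le_linear_of_frameOK (L := L) hR hU.ne' hU1 hK
  have hm := sum_norm_framePosKernel_mul_dist_le_of_frameOK (L := L) hK hR
  -- the optimised dilation
  obtain ⟨t, ht0, ht1, hsm, hbd⟩ := mixed_opt_arith (a := a) (w := β / (2 * ((2 * (2 * M) : ℕ) : ℝ))) he ha.le hkR hk0 hmR hu hw
  -- smallness for the dilated row: `e·a·(p + t q) ≤ 2e·a·p ≤ 1/2`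
  have hsmall' : Real.exp 1 * a * (4 * Real.exp 1 ^ 4 *
      (256 * ((4 / 3) * Real.sqrt (24 * π ^ 2 * (R.Gfr 0 + 1) * (R.Gfr 2 + 1)) + (128 / 15) * (R.Gfr 0 + 1)) * |U| +
        t * (2 * (((Nsc : ℝ) + 1) * U ^ 2 * (6 * (Real.pi * R.Gfr 1 / 2 + Real.pi ^ 2 * R.Gfr 2 / (2 * Real.sqrt 2) + Real.pi ^ 3 * R.Gfr 3 / 8))))) +
      16 * Real.exp 1 ^ 8 * Real.sqrt (2 * (7 + 1606732)) ^ 2 * |U|) ≤ 1 / 2 := by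
    refine le_trans (mul_le_mul_of_nonneg_left hsm (mul_nonneg he.le ha.le)) (le_trans (le_of_eq ?_) hsmall)
    ring
  have h := twoLegGrid_space_row_scaleZero_of_frameOK_dil hK hR hU hU1 hβ hL hM ha hA ht0 ht1 hℓ hm hsmall' σ p₀
  refine h.trans (hbd.trans (le_of_eq ?_))
  rw [mul_pow, sq_abs]
  ring

end FrameBaseMixed

end Summit.HubbardSuperconductivity.HubbardSuperconductivity.Theorems.EngineV8

end
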